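import Literature.NumberTheory.EllipticCurves.MultiplicativeReductionTransvectionProofs
import Summits.BirchSwinnertonDyer.Rank1Residual.GaloisImage.MultiplicativeLargeImage
import Summits.BirchSwinnertonDyer.Rank1Residual.X11b.TamagawaQuadraticPlaces
import HarnessLib

/-!
# Class X11b: `Mult ∧ Irr ∧ p ∤ ord_p Δ_min ⟹ ρ̄_{E,p}` SURJECTIVE — the non-surjective corner of X11b is a decidable local condition (cell `b2b-bsdres`, sub-cell `multr1-p2`, gen 8)

HONEST FRAMING (verbatim, cell `b2b-bsdres`): the goal of the cell is to DELETE the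
COMBINATION-SHAPED residual classes for ALL analytic-rank `≤ 1` curves over `ℚ` — "full BSD
formula for every rank `≤ 1` curve in class `C`" assembled STRICTLY from published theorems — so
that the rank-`≤ 1` remainder becomes exactly the CONSTRUCTION-SHAPED classes, which are TYPED
(missing-input Props), NOT attempted; this is not "finishing BSD". Research route `p2` for class
X11b ("BDP + Skinner's converse theorem + Kolyvagin"); no claim beyond the stated class; nothing
booked; X11b stays CONSTRUCTION-SHAPED. Theorems only (no definition, no named fact).

## What this file does

The whole-class theorem of the route (`BDPRouteWholeClass.lean`,
`bsdp_of_classX11b_five_of_typedInputs`) carries the typed input (T4) "the non-surjective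
corner": `Typed.MissingPPartAt` for the X11b pairs with `ρ̄_{E,p}` NOT onto (class-wide `64`
Cremona pairs, all at `p = 5`, images `5S4`/`5Ns`, all with `5 ∣ ord_5 Δ_min` — REPORT §13.3).
Gen 7 of x11c proved `Surj` at every multiplicative `p ≥ 11` (`surj_of_mult_of_irr_of_eleven_le`,
Bilu–Parent–Rebolledo / BDMTV).  This file proves the complementary LOCAL criterion, classical
(Silverman *ATAEC* V.6 Prop. 6.1 + Serre 1972 Prop. 15) and now a tree theorem
(`WeierstrassCurve.exists_inertia_transvection_of_hasMultiplicativeReductionAt_of_not_dvd`,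
`Literature/NumberTheory/EllipticCurves/MultiplicativeReductionTransvectionProofs.lean`):

* `dvd_card_map_range_of_transvection` — a Galois element acting on `E[p]` as a non-trivial
  transvection (moves a point, fixes every `σP - P`) has image of order `p` in `GL₂(𝔽_p)`, so
  `p ∣ #G` (`(1 + N)^p = 1 + pN = 1` for `N² = 0`).
* **`surj_of_mult_of_irr_of_not_dvd`** — for `E/ℚ` globally minimal, `p` odd:
  `Mult W p → Irr W p → ¬ p ∣ ord_p Δ_min(E) → Surj W p`.  The inertia group at `p` contains a
  transvection on `E[p]` (ATAEC V.6.1 at `ℓ = p`), so `p ∣ #ρ̄(Γ_ℚ)`; an irreducible `G` of order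
  divisible by `p` with `det` onto contains `SL₂(𝔽_p)` (Serre Prop. 15,
  `not_dvd_card_of_not_hasSurjectiveModNGaloisRep`).
* `dvd_padicValInt_of_mult_of_irr_of_not_surj` — contrapositive: at an odd
  multiplicative `p` with `E[p]` irreducible and `ρ̄` NOT onto, `p ∣ ord_p Δ_min`
  (= Serre's "peu ramifié" condition; with x11c's `eq_five_or_eq_seven_…` also `p ∈ {5, 7}` and
  with `surj_of_irr_of_ram` no (ram) prime): `ClassX11b.not_surj_shape`.

So the non-surjective corner (T4) of the whole-class theorem is supported on the DECIDABLE
sub-population `p ∈ {5,7} ∧ p ∣ ord_p Δ_min ∧ ¬Ram` of X11b (the consumer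
`BDPRouteWholeClassLarge.lean` restates the class theorem accordingly); every X11b pair with
`p ∤ ord_p Δ_min` — Serre's "très ramifié" pairs, `2 075 ...`-many class-wide is not claimed here;
see the unit's REPORT §14 for the census — is on the surjective branch (Kato–Wuthrich divisibility,
Skinner Thm. C via (ram) at `p` itself is NOT implied: (ram) asks for a SECOND multiplicative prime).
Nothing is booked; labels unchanged.

## References

* [SilvermanATAEC1994] J. H. Silverman, *Advanced Topics*, V.6 Prop. 6.1 (p. 410).
* [SerreInventiones1972] J.-P. Serre, Invent. Math. 15 (1972), §1.12, §2.4 Prop. 15, §5.4.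
* [BalakrishnanEtAl2019] Balakrishnan–Dogra–Müller–Tuitman–Vonk, Ann. of Math. 189 (2019), Thm. 1.2.
-/

noncomputable section

open scoped Classical NumberField
open IsDedekindDomain Field Matrix NumberField
open WeierstrassCurve Literature.NumberTheory.EllipticCurves Literature.NumberTheory.GaloisRepresentations
  Literature.NumberTheory.GaloisRepresentations.Serre1972 Rat.HeightOneSpectrum
  Literature.NumberTheory.EllipticCurves.Rank1Residual
  Literature.NumberTheory.EllipticCurves.BalakrishnanEtAl2019

namespace Summit.BirchSwinnertonDyer.Rank1Residual.GaloisImage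

variable (W : WeierstrassCurve ℚ) [W.IsElliptic] (p : ℕ) [hp : Fact p.Prime]

/-! ### A transvection in the image has order `p` -/

omit [W.IsElliptic] in
/-- **A transvection in `ρ̄_{E,p}(Γ_ℚ)` forces `p ∣ #G`.**  In a frame `(e, Φ)` of `E[p]`, if
`g ∈ Γ_ℚ` moves some point of `E[p]` and fixes `gP - P` for every `P`, then `M = Φ(ρ̄ g)` satisfies
`(M - 1)² = 0 ≠ M - 1`, so `M^p = (1 + N)^p = 1 + pN = 1`, `M` has order `p`, and
`p ∣ #Φ(ρ̄(Γ_ℚ))`. [cite: SilvermanATAEC1994, V.6 Prop. 6.1 and Remark 6.1.1] -/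
theorem dvd_card_map_range_of_transvection
    (Φ : Multiplicative (AddAut (geomTorsion W p)) ≃* GL (Fin 2) (ZMod p))
    (e : geomTorsion W p ≃+ (Fin 2 → ZMod p))
    (he : ∀ (g : Multiplicative (AddAut (geomTorsion W p))) (x : geomTorsion W p),
      e (Multiplicative.toAdd g x) =
        ((Φ g : GL (Fin 2) (ZMod p)) : Matrix (Fin 2) (Fin 2) (ZMod p)) *ᵥ e x)
    {g : absoluteGaloisGroup ℚ} (hmove : ∃ P : geomTorsion W p, g • P ≠ P)
    (hunip : ∀ P : geomTorsion W p, g • (g • P - P) = g • P - P) :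
    p ∣ Nat.card ((galoisRepTorsion W p).range.map Φ.toMonoidHom) := by
  set M : GL (Fin 2) (ZMod p) := Φ (galoisRepTorsion W p g) with hM
  set N : Matrix (Fin 2) (Fin 2) (ZMod p) := (M : Matrix (Fin 2) (Fin 2) (ZMod p)) - 1 with hN
  have heg : ∀ x : geomTorsion W p,
      e (g • x) = (M : Matrix (Fin 2) (Fin 2) (ZMod p)) *ᵥ e x := fun x ↦ by
    rw [hM, ← he, galoisRepTorsion_apply]
  have hNe : ∀ x : geomTorsion W p, N *ᵥ e x = e (g • x - x) := fun x ↦ by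
    rw [hN, Matrix.sub_mulVec, Matrix.one_mulVec, map_sub, heg]
  -- `N² = 0`
  have hNN : N * N = 0 := by
    refine Matrix.mulVec_injective (funext fun y ↦ ?_)
    obtain ⟨x, rfl⟩ := e.surjective y
    rw [← Matrix.mulVec_mulVec, hNe, hNe, hunip, sub_self, map_zero, Matrix.zero_mulVec]
  -- `N ≠ 0`
  have hN0 : N ≠ 0 := by
    obtain ⟨P, hP⟩ := hmove
    intro h0
    apply hP
    have h1 := hNe P
    rw [h0, Matrix.zero_mulVec] at h1
    exact (sub_eq_zero.mp (e.injective (by rw [map_zero]; exact h1.symm)))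
  -- `M^n = 1 + n N`
  have hM1 : (M : Matrix (Fin 2) (Fin 2) (ZMod p)) = 1 + N := by rw [hN, add_sub_cancel]
  have hpow : ∀ n : ℕ, (M : Matrix (Fin 2) (Fin 2) (ZMod p)) ^ n = 1 + n • N := by
    intro n
    induction n with
    | zero => rw [pow_zero, zero_smul, add_zero]
    | succ n ih =>
      rw [pow_succ, ih, hM1, add_mul, one_mul, mul_add, mul_one, smul_mul_assoc, hNN, smul_zero,
        add_zero, succ_nsmul]
      abel
  have hMp : M ^ p = 1 := by
    apply Units.ext
    rw [Units.val_pow_eq_pow_val, Units.val_one, hpow, ← Nat.cast_smul_eq_nsmul (ZMod p),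
      ZMod.natCast_self, zero_smul, add_zero]
  have hM1' : M ≠ 1 := by
    intro h
    apply hN0
    rw [hN, h, Units.val_one, sub_self]
  have hord : orderOf M = p := orderOf_eq_prime hMp hM1'
  have h := Subgroup.orderOf_dvd_natCard _ (apply_galoisRepTorsion_mem_map_range W p Φ g)
  rwa [hord] at h

/-! ### The surjectivity criterion -/

omit [W.IsElliptic] hp in
/-- **`𝔪_v = p 𝓞_v`** for the place `v ∋ p` of `ℚ` (`e(v ∣ p) = 1`): every element of the maximal
ideal of `𝓞_v = v.adicCompletionIntegers ℚ` is a multiple of `p` — transported from `ℤ_[p]`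
(`PadicInt.maximalIdeal_eq_span_p`) along `padicIntEquiv`.  (Same statement and proof as
`Literature.NumberTheory.DiophantineGeometry.natCast_dvd_of_mem_maximalIdeal_adicCompletionIntegers`
of the generalized-Fermat files, restated here to keep the X11b import closure free of them.)
[folklore] -/
theorem natCast_dvd_of_mem_maximalIdeal_of_primesEquiv_eq {v : HeightOneSpectrum (𝓞 ℚ)}
    (hv : (primesEquiv v : ℕ) = p) :
    ∀ c ∈ IsLocalRing.maximalIdeal (v.adicCompletionIntegers ℚ),
      ((p : ℕ) : v.adicCompletionIntegers ℚ) ∣ c := by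
  intro c hc
  haveI : Fact (Nat.Prime (primesEquiv (R := 𝓞 ℚ) v : ℕ)) := ⟨(primesEquiv v).2⟩
  set e := (adicCompletionIntegers.padicIntEquiv v).toRingEquiv with he
  have hc' : e c ∈ IsLocalRing.maximalIdeal ℤ_[(primesEquiv (R := 𝓞 ℚ) v : ℕ)] := by
    rw [IsLocalRing.mem_maximalIdeal, mem_nonunits_iff] at hc ⊢
    intro hu
    exact hc (by simpa using hu.map e.symm)
  rw [PadicInt.maximalIdeal_eq_span_p, Ideal.mem_span_singleton] at hc'
  obtain ⟨d, hd⟩ := hc'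
  refine ⟨e.symm d, ?_⟩
  have h1 : c = e.symm (e c) := (e.symm_apply_apply c).symm
  rw [h1, hd, map_mul, map_natCast]
  congr 1
  exact congrArg Nat.cast hv

variable [W.IsGloballyMinimal]

/-- **`Mult ∧ Irr ∧ p ∤ ord_p Δ_min ⟹ Surj` (`p` odd).**  For a globally minimal `E/ℚ`, an odd
prime `p` of multiplicative reduction with `E[p]` irreducible and `p ∤ ord_p Δ_min(E)` (Serre's
"très ramifié" case; equivalently `p ∤ ord_p j(E)`), `ρ̄_{E,p}` is onto `GL₂(𝔽_p)`: the inertia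
group at `p` contains a transvection on `E[p]` (Silverman *ATAEC* V.6 Prop. 6.1 at `ℓ = p`, the
tree's `exists_inertia_transvection_of_hasMultiplicativeReductionAt_of_not_dvd`), so `p ∣ #ρ̄(Γ_ℚ)`
(`dvd_card_map_range_of_transvection`), which for an irreducible image with `det` onto forces
`ρ̄(Γ_ℚ) ⊇ SL₂(𝔽_p)` (Serre 1972 Prop. 15, `not_dvd_card_of_not_hasSurjectiveModNGaloisRep`).
[cite: SilvermanATAEC1994, V.6 Prop. 6.1 (p. 410)] [cite: SerreInventiones1972, §2.4 Prop. 15 and §5.4] -/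
theorem surj_of_mult_of_irr_of_not_dvd (hp2 : p ≠ 2) (hmult : Mult W p) (hirr : Irr W p)
    (hΔ : ¬ p ∣ padicValInt p W.minimalDiscriminantInt) : Surj W p := by
  have hpp : p.Prime := hp.out
  by_contra hns
  obtain ⟨e, Φ, he, -, -, -, -⟩ := exists_frame_galoisRepTorsion_rat W p
  have hG := not_dvd_card_of_not_hasSurjectiveModNGaloisRep W p Φ e he hirr hns
  -- the place `v` of `𝓞 ℚ` above `p`
  obtain ⟨v, hv⟩ : ∃ v : HeightOneSpectrum (𝓞 ℚ), (primesEquiv v : ℕ) = p :=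
    ⟨primesEquiv.symm ⟨p, hpp⟩, by rw [Equiv.apply_symm_apply]⟩
  have hvp : (p : 𝓞 ℚ) ∈ v.asIdeal := by
    have hgen : natGenerator v = p := hv
    have h := (natGenerator_dvd_iff v).mp dvd_rfl
    rw [← map_natCast (Rat.IsIntegralClosure.intEquiv (𝓞 ℚ)), Ideal.apply_mem_of_equiv_iff] at h
    rwa [hgen] at h
  have hmult' : haveI := Fact.mk (primesEquiv v).2
      W.HasMultiplicativeReductionAtPrime (primesEquiv v) := by
    have key : ∀ (q : ℕ) (hq : Fact q.Prime), q = p →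
        @WeierstrassCurve.HasMultiplicativeReductionAtPrime W q hq := by
      rintro q hq rfl; exact hmult
    exact key _ _ hv
  have hmultv : W.HasMultiplicativeReductionAt v :=
    (W.hasMultiplicativeReductionAtPrime_iff_hasMultiplicativeReductionAt_ringOfIntegers v).mp hmult'
  have hgen := natCast_dvd_of_mem_maximalIdeal_of_primesEquiv_eq p hv
  have hndvd : ¬ p ∣ W.ordMinimalDiscriminant v := by
    rwa [X11b.ordMinimalDiscriminant_eq_padicValInt W v hv]
  -- the transvection in the inertia group at `p`
  obtain ⟨τ, -, hmove, hunip⟩ :=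
    W.exists_inertia_transvection_of_hasMultiplicativeReductionAt_of_not_dvd p hp2 v hvp hmultv
      hndvd hgen
  exact hG (dvd_card_map_range_of_transvection W p Φ e he hmove hunip)

/-- **Contrapositive: a non-surjective irreducible `ρ̄_{E,p}` at an odd multiplicative `p` is peu
ramifié, `p ∣ ord_p Δ_min`.** [cite: SilvermanATAEC1994, V.6 Prop. 6.1 (p. 410)]
[cite: SerreInventiones1972, §2.4 Prop. 15] -/
theorem dvd_padicValInt_of_mult_of_irr_of_not_surj (hp2 : p ≠ 2) (hmult : Mult W p)
    (hirr : Irr W p) (hns : ¬ Surj W p) : p ∣ padicValInt p W.minimalDiscriminantInt := by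
  by_contra hΔ
  exact hns (surj_of_mult_of_irr_of_not_dvd W p hp2 hmult hirr hΔ)

end Summit.BirchSwinnertonDyer.Rank1Residual.GaloisImage

/-! ### The shape of the non-surjective corner of X11b -/

namespace Summit.BirchSwinnertonDyer.Rank1Residual

open GaloisImage

variable (W : WeierstrassCurve ℚ) [W.IsElliptic] [W.IsGloballyMinimal] (p : ℕ) [hp : Fact p.Prime]

/-- **X11b, non-surjective corner: `p ∣ ord_p Δ_min` and no (ram) prime** (at any odd `p`).  An
X11b pair (`r = 1 ∧ p ≠ 2 ∧ Mult ∧ Irr`) with `ρ̄_{E,p}` not onto has `p ∣ ord_p Δ_min(E)`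
(this file) and no second multiplicative prime `q` with `p ∤ ord_q Δ_min`
(`surj_of_irr_of_ram`).  Data (REPORT §13.3): all `64` class-wide Cremona instances, all at
`p = 5`. [cite: SilvermanATAEC1994, V.6 Prop. 6.1 (p. 410)] -/
theorem ClassX11b.dvd_and_not_ram_of_not_surj (hX : ClassX11b W p) (hns : ¬ Surj W p) :
    p ∣ padicValInt p W.minimalDiscriminantInt ∧ ¬ Ram W p :=
  ⟨dvd_padicValInt_of_mult_of_irr_of_not_surj W p hX.2.1 hX.2.2.1 hX.2.2.2 hns,
    fun hram ↦ hns (surj_of_irr_of_ram W p hX.2.2.2 hram)⟩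

/-- **X11b, non-surjective corner at `p ≥ 5`: `p ∈ {5, 7}`, `p ∣ ord_p Δ_min`, `¬Ram`** — the
typed input (T4) of the whole-class theorem lives on this decidable sub-population (given the
named fact `hB` = BDMTV 2019 Thm. 1.2 / Bilu–Parent–Rebolledo for `p ∈ {5,7}`).
[cite: BalakrishnanEtAl2019, §1 Thm. 1.2 (arXiv:1711.05846 p. 2)]
[cite: SilvermanATAEC1994, V.6 Prop. 6.1 (p. 410)] -/
theorem ClassX11b.not_surj_shape (hB : thm12_not_le_normalizer_splitCartan) (hX : ClassX11b W p)
    (h5 : 5 ≤ p) (hns : ¬ Surj W p) :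
    (p = 5 ∨ p = 7) ∧ p ∣ padicValInt p W.minimalDiscriminantInt ∧ ¬ Ram W p :=
  ⟨eq_five_or_eq_seven_of_mult_of_irr_of_not_surj W p hB h5 hX.2.2.1 hX.2.2.2 hns,
    ClassX11b.dvd_and_not_ram_of_not_surj W p hX hns⟩

/-- **X11b: `ρ̄_{E,p}` is onto as soon as `p ∤ ord_p Δ_min`** (any odd `p`; no named fact).
[cite: SilvermanATAEC1994, V.6 Prop. 6.1 (p. 410)] -/
theorem ClassX11b.surj_of_not_dvd (hX : ClassX11b W p)
    (hΔ : ¬ p ∣ padicValInt p W.minimalDiscriminantInt) : Surj W p :=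
  surj_of_mult_of_irr_of_not_dvd W p hX.2.1 hX.2.2.1 hX.2.2.2 hΔ

/-- **X11a (rank 0 sister class) likewise**: `¬Surj ⟹ p ∣ ord_p Δ_min` on `ClassX11a`.
[cite: SilvermanATAEC1994, V.6 Prop. 6.1 (p. 410)] -/
theorem ClassX11a.surj_of_not_dvd (hX : ClassX11a W p)
    (hΔ : ¬ p ∣ padicValInt p W.minimalDiscriminantInt) : Surj W p :=
  surj_of_mult_of_irr_of_not_dvd W p hX.2.1 hX.2.2.1 hX.2.2.2.1 hΔ

end Summit.BirchSwinnertonDyer.Rank1Residual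

end
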